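import Literature.Geometry.Symplectic.SymplecticArea
import Literature.Geometry.Symplectic.TaubesCanonicalClassSymplecticCurveFour
import HarnessLib

/-!
# Taubes curves: the conclusion of Taubes's theorem `SW ⇒ Gr` as a structure on named objects

Topic `Literature/Geometry/Symplectic`. C. H. Taubes, *The Seiberg–Witten and Gromov invariants*,
Math. Res. Lett. 2 (1995) 221–238: Thm. A (1) ("The Poincaré dual to the canonical bundle `K` of
`X` is represented by the fundamental class of an embedded, symplectic curve"), §3 (p. 228: the
curve is "a union `𝒞 = ∪ᵢ 𝒞ᵢ` of a finite number of connected, pairwise disjoint submanifolds",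
counted "with integer multiplicities"; "the restriction of the symplectic form `ω` … orients `Σ` …
the integral of `ω` over `Σ` is positive"; the adjunction formula (3.2)
`2 - 2g + e · e = -c₁(K) · e`), Prop. 4.2 ("Let `Σ` be any such component, let `g = genus(Σ)` and
let `e ∈ H²(X; ℤ)` be the Poincaré dual to the fundamental class of `Σ`. Then `g = 1 + e · e`");
D. McDuff, D. Salamon, *Introduction to Symplectic Topology* (3rd ed. 2017), §13.3: (13.3.17)
`2g - 2 = C · C + K · C`, (13.3.18) `Aᵢ · Aⱼ = 0`, Cor. 13.3.23 ("`A` can be represented by a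
symplectic submanifold `C = C₁ ∪ ⋯ ∪ C_ℓ`", "If `A = 0` then `C = ∅`"), Cor. 13.3.24 (ii) ("The
canonical class `K` is Poincaré dual to a symplectic submanifold") and (iii) ("`K · [ω] ≥ 0` with
equality if and only if `K = 0`", proof: "`K · [ω] = ∫_C ω`").

The named fact `taubes_canonicalClass_symplecticCurve_four`
(`TaubesCanonicalClassSymplecticCurveFour.lean`) packages Taubes's theorem existentially
(`∃ μ K …`, components with SOME orientations and SOME additive functional positive on them).
This file names the object the theorem produces, on NAMED objects and as printed:

* `TaubesCurve s hs hcl μ K E` — a Taubes curve representing `E ⌢ [N]_μ` with canonical class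
  `K`: finitely many compact connected surfaces `S i` smoothly embedded by `b i` with pairwise
  disjoint images, `s` non-degenerate on each, each ORIENTED BY `s` — its `ℤ`-orientation `μS i` has
  positive symplectic area `0 < ⟨[s], (b i)_*[S i] ⊗ 1⟩` (`periodFunctional`, `SymplecticArea.lean`;
  this pins `μS i`, `eq_of_periodFunctional_map_pos`) — with multiplicities `m i ≥ 1`,
  `Σ (m i) (b i)_*[S i] = E ⌢ [N]_μ`, and the adjunction formula `rank H₁(S i) - 2 = σ · σ + K · σ`
  for the Poincaré dual `σ` of each component; `HasTaubesCurve s hs hcl μ K E := Nonempty _`.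
  Taubes's Thm. A (1) asserts, for a closed symplectic `(N, s)` with symplectic orientation `μ`
  (`μ.IsSymplecticOrientationOf s`) and `b₂⁺ > 1` (Li–Liu: or `b₂⁺ = 1` under the wall-crossing
  hypothesis), `HasTaubesCurve s hs hcl μ K_J K_J` for a (generic) `s`-compatible `J` — hypothesis
  (C) of `taubes_canonicalClass_symplecticCurve_four_of_hasTaubesCurve` in
  `TaubesCanonicalClassSymplecticCurveFourProofs.lean`, the residual Seiberg–Witten content.

PROVED here for every Taubes curve `C` (no named facts): the component classes `C.cls i` are
non-torsion (`cls_not_mem_torsion`); their Poincaré duals `C.pd i` (`poincareDualityMap_pd`, by the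
tree's `poincare_duality`) satisfy `σᵢ · σⱼ = 0` for `i ≠ j` (`cupPairing_pd_pd_eq_zero`, Bredon VI
Thm. 11.10 / McDuff–Salamon (13.3.18)), `E · σᵢ = mᵢ σᵢ²` (`cupPairing_pd_eq`), `E = Σ mᵢ σᵢ`
(`eq_sum_smul_pd`), `E² = Σ mᵢ² σᵢ²` (`cupPairing_self_eq_sum`), the adjunction identity on `σᵢ`
(`finrank_sub_two_eq`) and, for the canonical curve `E = K`, Taubes's genus formula
`rank H₁(Cᵢ) - 2 = (1 + mᵢ) σᵢ²` (`finrank_sub_two_eq_of_canonical`; `g = 1 + e · e` for `mᵢ = 1`,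
Prop. 4.2); the area identities `E · [s] = Σ mᵢ ∫_{Cᵢ} s ≥ 0` (`period_eq_sum`, `period_nonneg`),
`E · [s] = 0 ↔ E = 0 ↔` the curve is empty (`period_eq_zero_iff`, `r_eq_zero_of_eq_zero`,
`eq_zero_of_r_eq_zero`; McDuff–Salamon Cor. 13.3.23 / 13.3.24 (iii)), `0 < E · [s]` for `E ≠ 0`
(`period_pos`); the empty curve `TaubesCurve.empty` represents `0`; and `TaubesCurve.conclusion` /
`HasTaubesCurve.conclusion` deliver conjunct (iii) of `taubes_canonicalClass_symplecticCurve_four`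
with the area functional `A := periodLinearMap s hs hcl` (the symplectic area).

## References

* C. H. Taubes, The Seiberg–Witten and Gromov invariants, Math. Res. Lett. 2 (1995) 221–238,
  Thm. A (1), §3 (p. 228, (3.2)), Prop. 4.2. [Taubes1995]
* D. McDuff, D. Salamon, Introduction to Symplectic Topology, 3rd ed. (2017), §13.3 (13.3.17),
  (13.3.18), Cor. 13.3.23, Cor. 13.3.24 (ii)–(iii). [McDuffSalamon2017]
* G. E. Bredon, Topology and Geometry, GTM 139 (1993), Ch. VI Thm. 11.10. [Bredon1993]
* A. Hatcher, Algebraic Topology (2002), §3.3 Thm. 3.30. [HatcherAT2002]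
-/

noncomputable section

namespace Literature.Geometry.Symplectic

open scoped Manifold ContDiff Topology ContinuousMap
open Set Function
open Literature.Geometry.Kaehler (MForm IsSmoothForm IsClosedForm)
open Literature.AlgebraicTopology.SingularHomology

/-- Local notation: `𝔼 n` is the model space `EuclideanSpace ℝ (Fin n)`. -/
local notation "𝔼" n:arg => EuclideanSpace ℝ (Fin n)

/-- Local notation: `ℛ n` is the model with corners `modelWithCornersSelf ℝ (EuclideanSpace ℝ (Fin n))`
(Mathlib's `𝓡 n`; with the whole of Mathlib imported through the statement file the scoped token is
not available here). -/
local notation "ℛ" n:arg => modelWithCornersSelf ℝ (EuclideanSpace ℝ (Fin n))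

section TaubesCurve

variable {N : Type} [TopologicalSpace N] [T2Space N] [CompactSpace N] [ChartedSpace (𝔼 4) N]
  [IsManifold (ℛ 4) ∞ N]

/-- **A Taubes curve representing `E ⌢ [N]_μ`, with canonical class `K`** (the object produced by
Taubes 1995, Prop. 4.2 / Thm. A (1), with §3: "a compact, complex curve `𝒞` in `X` which, as a
point set, is a union `𝒞 = ∪ᵢ 𝒞ᵢ` of a finite number of connected, pairwise disjoint
submanifolds of `X`", counted "with integer multiplicities", "the restriction of the symplectic form
`ω` to a pseudo-holomorphic submanifold `Σ` is always symplectic, and so orients `Σ` … the integral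
of `ω` over `Σ` is positive", and the adjunction formula (3.2) `2 - 2g + e · e = -c₁(K) · e` for each
component with Poincaré dual `e`; McDuff–Salamon 2017, Cor. 13.3.23 with (13.3.17)
`2g - 2 = Cᵢ · Cᵢ + K · Cᵢ`), typed over the tree's singular (co)homology for a closed `2`-form `s`
on a closed `4`-manifold `N`, a `ℤ`-orientation `μ` of `N` and classes `K E ∈ H²(N; ℤ)`: finitely
many compact connected surfaces `S i`, smoothly embedded by `b i` with pairwise disjoint images, on
which `s` is non-degenerate, each carrying the `ℤ`-orientation `μS i` of POSITIVE symplectic area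
`0 < ⟨[s], (b i)_*[S i] ⊗ 1⟩` (`periodFunctional`; the orientation induced by `s`, unique by
`eq_of_periodFunctional_map_pos`) and a multiplicity `m i ≥ 1`, with
`Σ (m i) (b i)_*[S i] = E ⌢ [N]_μ` and `rank H₁(S i) - 2 = σ · σ + K · σ` for the Poincaré dual `σ`
of each component (`2g - 2 = e · e + K · e`).  Taubes's Theorem A (1) for a closed symplectic
`(N, s)` with symplectic orientation `μ` and an `s`-compatible `J` produces a
`TaubesCurve s hs hcl μ K_J K_J`. [cite: Taubes1995, §3 (p. 228, (3.2)), Thm. A (1), Prop. 4.2]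
[cite: McDuffSalamon2017, §13.3 (13.3.17) and Cor. 13.3.23] -/
structure TaubesCurve (s : MForm (ℛ 4) N ℝ 2) (hs : IsSmoothForm s) (hcl : IsClosedForm s)
    (μ : HomologicalOrientation ℤ N 4) (K E : singularCohomology ℤ ℤ N 2) where
  /-- The number of components. -/
  r : ℕ
  /-- The components, abstract compact connected smooth surfaces. -/
  S : Fin r → Type
  [instTopologicalSpace : ∀ i, TopologicalSpace (S i)]
  [instCompactSpace : ∀ i, CompactSpace (S i)]
  [instConnectedSpace : ∀ i, ConnectedSpace (S i)]
  [instChartedSpace : ∀ i, ChartedSpace (𝔼 2) (S i)]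
  [instIsManifold : ∀ i, IsManifold (ℛ 2) ∞ (S i)]
  /-- The embeddings of the components. -/
  b : ∀ i, S i → N
  isSmoothEmbedding : ∀ i, Manifold.IsSmoothEmbedding (ℛ 2) (ℛ 4) ∞ (b i)
  /-- The orientations of the components (induced by `s`: `area_pos`). -/
  μS : ∀ i, HomologicalOrientation ℤ (S i) 2
  /-- The multiplicities of the components. -/
  m : Fin r → ℕ
  one_le : ∀ i, 1 ≤ m i
  /-- `s` is non-degenerate on each component (a symplectic surface). -/
  nondegenerate : ∀ i y (v : TangentSpace (ℛ 2) y), v ≠ 0 → ∃ w : TangentSpace (ℛ 2) y,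
    s (b i y) ![mfderiv (ℛ 2) (ℛ 4) (b i) y v, mfderiv (ℛ 2) (ℛ 4) (b i) y w] ≠ 0
  /-- Each component has positive symplectic area in its orientation `μS i`. -/
  area_pos : ∀ i, 0 < periodFunctional s hs hcl (singularHomology.map ℤ ℤ
    ⟨b i, (isSmoothEmbedding i).isEmbedding.continuous⟩ 2 (μS i).fundamentalClass)
  /-- The components are pairwise disjoint. -/
  disjoint : Pairwise fun i j ↦ Disjoint (Set.range (b i)) (Set.range (b j))
  /-- The weighted sum of the components is Poincaré dual to `E`. -/
  sum_eq : ∑ i, (m i : ℤ) • singularHomology.map ℤ ℤ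
      ⟨b i, (isSmoothEmbedding i).isEmbedding.continuous⟩ 2 (μS i).fundamentalClass =
    poincareDualityMap μ two_add_two_eq_four E
  /-- The adjunction formula `rank H₁(S i) - 2 = σ · σ + K · σ` for the Poincaré dual `σ` of each
  component. -/
  adjunction : ∀ i (σ : singularCohomology ℤ ℤ N 2),
    poincareDualityMap μ two_add_two_eq_four σ = singularHomology.map ℤ ℤ
      ⟨b i, (isSmoothEmbedding i).isEmbedding.continuous⟩ 2 (μS i).fundamentalClass →
    (Module.finrank ℤ (singularHomology ℤ ℤ (S i) 1) : ℤ) - 2 =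
      cupPairing μ two_add_two_eq_four σ σ + cupPairing μ two_add_two_eq_four K σ

namespace TaubesCurve

variable {s : MForm (ℛ 4) N ℝ 2} {hs : IsSmoothForm s} {hcl : IsClosedForm s}
  {μ : HomologicalOrientation ℤ N 4} {K E : singularCohomology ℤ ℤ N 2}

/-- The topology of a component of a Taubes curve. [folklore] -/
instance (C : TaubesCurve s hs hcl μ K E) (i : Fin C.r) : TopologicalSpace (C.S i) :=
  C.instTopologicalSpace i

/-- A component of a Taubes curve is compact. [folklore] -/
instance (C : TaubesCurve s hs hcl μ K E) (i : Fin C.r) : CompactSpace (C.S i) :=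
  C.instCompactSpace i

/-- A component of a Taubes curve is connected. [folklore] -/
instance (C : TaubesCurve s hs hcl μ K E) (i : Fin C.r) : ConnectedSpace (C.S i) :=
  C.instConnectedSpace i

/-- A component of a Taubes curve is a surface charted on `ℝ²`. [folklore] -/
instance (C : TaubesCurve s hs hcl μ K E) (i : Fin C.r) : ChartedSpace (𝔼 2) (C.S i) :=
  C.instChartedSpace i

/-- A component of a Taubes curve is a `C^∞` surface. [folklore] -/
instance (C : TaubesCurve s hs hcl μ K E) (i : Fin C.r) : IsManifold (ℛ 2) ∞ (C.S i) :=
  C.instIsManifold i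

/-- The embedding of the `i`-th component as a continuous map. [folklore] -/
def bC (C : TaubesCurve s hs hcl μ K E) (i : Fin C.r) : C(C.S i, N) :=
  ⟨C.b i, (C.isSmoothEmbedding i).isEmbedding.continuous⟩

/-- `C.bC i` is `C.b i` as a function. [folklore] -/
@[simp]
theorem bC_apply (C : TaubesCurve s hs hcl μ K E) (i : Fin C.r) (y : C.S i) : C.bC i y = C.b i y :=
  rfl

/-- **The class `[Cᵢ] = (b i)_*[S i]_{μS i} ∈ H₂(N; ℤ)` of the `i`-th component.** [cite: Taubes1995, §3] -/
def cls (C : TaubesCurve s hs hcl μ K E) (i : Fin C.r) : singularHomology ℤ ℤ N 2 :=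
  singularHomology.map ℤ ℤ (C.bC i) 2 (C.μS i).fundamentalClass

/-- Unfolding `cls` to the spelling of the structure fields. [folklore] -/
theorem cls_eq (C : TaubesCurve s hs hcl μ K E) (i : Fin C.r) :
    C.cls i = singularHomology.map ℤ ℤ ⟨C.b i, (C.isSmoothEmbedding i).isEmbedding.continuous⟩ 2
      (C.μS i).fundamentalClass :=
  rfl

/-- `Σ mᵢ [Cᵢ] = E ⌢ [N]`. [cite: Taubes1995, Prop. 4.2] -/
theorem sum_smul_cls (C : TaubesCurve s hs hcl μ K E) :
    ∑ i, (C.m i : ℤ) • C.cls i = poincareDualityMap μ two_add_two_eq_four E :=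
  C.sum_eq

/-- `Σ mᵢ [Cᵢ] = E ⌢ [N]` for the scalar action of the bundled `ℤ`-module `H₂(N; ℤ)` (the form in
which the component-arithmetic theorems of the statement file, stated over a general coefficient
ring, read the weights; all `ℤ`-actions on an abelian group agree, `int_smul_eq_zsmul`). [folklore] -/
theorem sum_moduleSMul_cls (C : TaubesCurve s hs hcl μ K E) :
    ∑ i, (singularHomology ℤ ℤ N 2).isModule.smul (C.m i : ℤ) (C.cls i) =
      poincareDualityMap μ two_add_two_eq_four E := by
  rw [← C.sum_smul_cls]
  exact Finset.sum_congr rfl fun i _ ↦ int_smul_eq_zsmul _ _ _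

/-- **The symplectic area of the `i`-th component**, `∫_{Cᵢ} s = ⟨[s], [Cᵢ] ⊗ 1⟩ > 0`.
[cite: Taubes1995, §3 (p. 228)] -/
theorem area_cls_pos (C : TaubesCurve s hs hcl μ K E) (i : Fin C.r) :
    0 < periodFunctional s hs hcl (C.cls i) :=
  C.area_pos i

/-- **The components are non-torsion classes** (`∫_{Cᵢ} s ≠ 0`; McDuff–Salamon 2017, Ex. 4.4.5,
the tree's `map_fundamentalClass_not_mem_torsion_of_isSmoothEmbedding`). [cite: McDuffSalamon2017, Ex. 4.4.5] -/
theorem cls_not_mem_torsion [SecondCountableTopology N] (C : TaubesCurve s hs hcl μ K E) (i : Fin C.r) :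
    C.cls i ∉ Submodule.torsion ℤ (singularHomology ℤ ℤ N 2) :=
  map_fundamentalClass_not_mem_torsion_of_isSmoothEmbedding s hs hcl (C.b i) (C.isSmoothEmbedding i)
    (C.nondegenerate i) (C.μS i)

/-- **The Poincaré dual `σᵢ ∈ H²(N; ℤ)` of the `i`-th component**, `σᵢ ⌢ [N] = [Cᵢ]` (Poincaré
duality of the closed oriented `N`, Hatcher 2002 Thm. 3.30, the tree's `poincare_duality`).
[cite: HatcherAT2002, §3.3 Thm. 3.30] -/
def pd (C : TaubesCurve s hs hcl μ K E) (i : Fin C.r) : singularCohomology ℤ ℤ N 2 :=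
  (poincareDualityEquiv μ two_add_two_eq_four (poincare_duality μ two_add_two_eq_four)).symm (C.cls i)

/-- `σᵢ ⌢ [N] = [Cᵢ]`. [cite: HatcherAT2002, §3.3 Thm. 3.30] -/
@[simp]
theorem poincareDualityMap_pd (C : TaubesCurve s hs hcl μ K E) (i : Fin C.r) :
    poincareDualityMap μ two_add_two_eq_four (C.pd i) = C.cls i := by
  rw [pd, ← poincareDualityEquiv_apply μ two_add_two_eq_four (poincare_duality μ two_add_two_eq_four),
    LinearEquiv.apply_symm_apply]

/-- A class is the Poincaré dual of the `i`-th component iff it is `σᵢ`. [cite: HatcherAT2002, §3.3 Thm. 3.30] -/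
theorem poincareDualityMap_eq_cls_iff (C : TaubesCurve s hs hcl μ K E) (i : Fin C.r)
    (σ : singularCohomology ℤ ℤ N 2) :
    poincareDualityMap μ two_add_two_eq_four σ = C.cls i ↔ σ = C.pd i := by
  refine ⟨fun h ↦ (poincare_duality μ two_add_two_eq_four).1 ?_, fun h ↦ h ▸ C.poincareDualityMap_pd i⟩
  rw [h, poincareDualityMap_pd]

/-- **Distinct components pair to zero**: `σᵢ · σⱼ = 0` for `i ≠ j` (McDuff–Salamon (13.3.18);
Bredon VI Thm. 11.10, the tree's `cupPairing_eq_zero_of_components_disjoint`).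
[cite: McDuffSalamon2017, §13.3 (13.3.18)] [cite: Bredon1993, Ch. VI Thm. 11.10] -/
theorem cupPairing_pd_pd_eq_zero (C : TaubesCurve s hs hcl μ K E) {i j : Fin C.r} (hij : i ≠ j) :
    cupPairing μ two_add_two_eq_four (C.pd i) (C.pd j) = 0 :=
  cupPairing_eq_zero_of_components_disjoint μ C.bC (fun i ↦ (C.μS i).fundamentalClass) C.disjoint hij
    (C.poincareDualityMap_pd i) (C.poincareDualityMap_pd j)

/-- **`E · σᵢ = mᵢ σᵢ · σᵢ`** (the tree's `cupPairing_eq_mul_self_of_sum_components`; Taubes 1995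
Prop. 4.2, McDuff–Salamon (13.3.18)). [cite: Taubes1995, Prop. 4.2] [cite: McDuffSalamon2017, §13.3 (13.3.18)] -/
theorem cupPairing_pd_eq (C : TaubesCurve s hs hcl μ K E) (i : Fin C.r) :
    cupPairing μ two_add_two_eq_four E (C.pd i) = C.m i * cupPairing μ two_add_two_eq_four (C.pd i) (C.pd i) :=
  cupPairing_eq_mul_self_of_sum_components μ C.bC (fun i ↦ (C.μS i).fundamentalClass) C.disjoint
    (fun i ↦ (C.m i : ℤ)) C.sum_moduleSMul_cls (C.poincareDualityMap_pd i)

/-- **`E = Σ mᵢ σᵢ`** in `H²(N; ℤ)` (Poincaré duality; the tree's `eq_sum_smul_of_sum_components`).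
[cite: HatcherAT2002, §3.3 Thm. 3.30] -/
theorem eq_sum_smul_pd (C : TaubesCurve s hs hcl μ K E) : E = ∑ i, (C.m i : ℤ) • C.pd i :=
  (eq_sum_smul_of_sum_components μ C.bC (fun i ↦ (C.μS i).fundamentalClass) (fun i ↦ (C.m i : ℤ))
    C.sum_moduleSMul_cls C.pd C.poincareDualityMap_pd).trans
    (Finset.sum_congr rfl fun _ _ ↦ int_smul_eq_zsmul _ _ _)

/-- **`E · E = Σ mᵢ² σᵢ · σᵢ`** (the tree's `cupPairing_self_eq_sum_of_sum_components`; for `E = K`,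
with `K² = 2χ + 3σ`, the numerical constraint on the components of Taubes's canonical curve,
McDuff–Salamon Cor. 13.3.23/13.3.24). [cite: McDuffSalamon2017, §13.3 (13.3.18) and Cor. 13.3.23] -/
theorem cupPairing_self_eq_sum (C : TaubesCurve s hs hcl μ K E) :
    cupPairing μ two_add_two_eq_four E E =
      ∑ i, (C.m i : ℤ) * C.m i * cupPairing μ two_add_two_eq_four (C.pd i) (C.pd i) :=
  cupPairing_self_eq_sum_of_sum_components μ C.bC (fun i ↦ (C.μS i).fundamentalClass) C.disjoint
    (fun i ↦ (C.m i : ℤ)) C.sum_moduleSMul_cls C.pd C.poincareDualityMap_pd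

/-- **The adjunction formula on the named dual**: `rank H₁(Cᵢ) - 2 = σᵢ · σᵢ + K · σᵢ`
(Taubes 1995 (3.2); McDuff–Salamon (13.3.17)). [cite: Taubes1995, §3 (3.2)] [cite: McDuffSalamon2017, §13.3 (13.3.17)] -/
theorem finrank_sub_two_eq (C : TaubesCurve s hs hcl μ K E) (i : Fin C.r) :
    (Module.finrank ℤ (singularHomology ℤ ℤ (C.S i) 1) : ℤ) - 2 =
      cupPairing μ two_add_two_eq_four (C.pd i) (C.pd i) + cupPairing μ two_add_two_eq_four K (C.pd i) :=
  C.adjunction i (C.pd i) (C.poincareDualityMap_pd i)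

/-- **Taubes's genus formula for the canonical curve** (`E = K`): `rank H₁(Cᵢ) - 2 = (1 + mᵢ) σᵢ · σᵢ`,
i.e. `2g - 2 = (1 + m) e · e`; for multiplicity one, "`g = 1 + e · e`" (Taubes 1995, Prop. 4.2), and
for `mᵢ ≥ 2` with `σᵢ · σᵢ = 0`, tori (the tree's `sub_two_eq_mul_cupPairing_self_of_sum_components`).
[cite: Taubes1995, Prop. 4.2 and §3 (3.2)] -/
theorem finrank_sub_two_eq_of_canonical (C : TaubesCurve s hs hcl μ K K) (i : Fin C.r) :
    (Module.finrank ℤ (singularHomology ℤ ℤ (C.S i) 1) : ℤ) - 2 =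
      (1 + C.m i) * cupPairing μ two_add_two_eq_four (C.pd i) (C.pd i) :=
  sub_two_eq_mul_cupPairing_self_of_sum_components μ C.bC (fun i ↦ (C.μS i).fundamentalClass)
    C.disjoint (fun i ↦ (C.m i : ℤ)) C.sum_moduleSMul_cls (C.poincareDualityMap_pd i) (C.finrank_sub_two_eq i)

/-- **`E · [s] = Σ mᵢ ∫_{Cᵢ} s`**: the period of `s` on `E ⌢ [N]_μ` is the multiplicity-weighted sum
of the symplectic areas of the components (McDuff–Salamon 2017, proof of Cor. 13.3.24 (iii):
"`K · [ω] = ∫_C ω`"). [cite: McDuffSalamon2017, §13.3 Cor. 13.3.24 (iii) and its proof] -/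
theorem period_eq_sum (C : TaubesCurve s hs hcl μ K E) :
    periodFunctional s hs hcl (poincareDualityMap μ two_add_two_eq_four E) =
      ∑ i, (C.m i : ℝ) * periodFunctional s hs hcl (C.cls i) := by
  rw [← C.sum_smul_cls, map_sum]
  exact Finset.sum_congr rfl fun i _ ↦ by rw [map_zsmul, zsmul_eq_mul, Int.cast_natCast]

/-- **`E · [s] ≥ 0`** for a class represented by a Taubes curve (McDuff–Salamon 2017,
Cor. 13.3.24 (iii): "`K · [ω] ≥ 0`"; Taubes 1995, §3: positive areas, positive multiplicities).
[cite: McDuffSalamon2017, §13.3 Cor. 13.3.24 (iii)] [cite: Taubes1995, §3 (p. 228)] -/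
theorem period_nonneg (C : TaubesCurve s hs hcl μ K E) :
    0 ≤ periodFunctional s hs hcl (poincareDualityMap μ two_add_two_eq_four E) := by
  rw [C.period_eq_sum]
  exact Finset.sum_nonneg fun i _ ↦ (mul_pos (by exact_mod_cast C.one_le i) (C.area_cls_pos i)).le

/-- **A Taubes curve representing a class of zero area is empty** ("If `A = 0` then `C = ∅`",
McDuff–Salamon 2017, Cor. 13.3.23): if `E · [s] = 0` then `r = 0`. [cite: McDuffSalamon2017, Cor. 13.3.23] -/
theorem r_eq_zero_of_period_eq_zero (C : TaubesCurve s hs hcl μ K E)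
    (h0 : periodFunctional s hs hcl (poincareDualityMap μ two_add_two_eq_four E) = 0) : C.r = 0 := by
  by_contra hr
  have hterm : ∀ i, 0 < (C.m i : ℝ) * periodFunctional s hs hcl (C.cls i) := fun i ↦
    mul_pos (by exact_mod_cast C.one_le i) (C.area_cls_pos i)
  have hp := Finset.sum_pos (fun i _ ↦ hterm i) ⟨⟨0, Nat.pos_of_ne_zero hr⟩, Finset.mem_univ _⟩
  rw [← C.period_eq_sum, h0] at hp
  exact lt_irrefl _ hp

/-- An empty Taubes curve represents `0`: if `r = 0` then `E = 0` (Poincaré duality).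
[cite: HatcherAT2002, §3.3 Thm. 3.30] -/
theorem eq_zero_of_r_eq_zero (C : TaubesCurve s hs hcl μ K E) (hr : C.r = 0) : E = 0 := by
  rw [C.eq_sum_smul_pd]
  have : IsEmpty (Fin C.r) := hr ▸ Fin.isEmpty'
  exact Finset.sum_of_isEmpty _

/-- A Taubes curve representing `0` is empty (`Σ mᵢ ∫_{Cᵢ} s = 0 · [s] = 0`).
[cite: McDuffSalamon2017, Cor. 13.3.23] -/
theorem r_eq_zero_of_eq_zero (C : TaubesCurve s hs hcl μ K E) (hE : E = 0) : C.r = 0 :=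
  C.r_eq_zero_of_period_eq_zero (by rw [hE, map_zero, map_zero])

/-- **`E · [s] = 0` iff `E = 0`** for a class represented by a Taubes curve (McDuff–Salamon 2017,
Cor. 13.3.24 (iii): "with equality if and only if `K` … is zero"). [cite: McDuffSalamon2017, §13.3 Cor. 13.3.24 (iii)] -/
theorem period_eq_zero_iff (C : TaubesCurve s hs hcl μ K E) :
    periodFunctional s hs hcl (poincareDualityMap μ two_add_two_eq_four E) = 0 ↔ E = 0 :=
  ⟨fun h0 ↦ C.eq_zero_of_r_eq_zero (C.r_eq_zero_of_period_eq_zero h0),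
    fun hE ↦ by rw [hE, map_zero, map_zero]⟩

/-- **`0 < E · [s]` for a non-zero class represented by a Taubes curve.** [cite: McDuffSalamon2017, §13.3 Cor. 13.3.24 (iii)] -/
theorem period_pos (C : TaubesCurve s hs hcl μ K E) (hE : E ≠ 0) :
    0 < periodFunctional s hs hcl (poincareDualityMap μ two_add_two_eq_four E) :=
  lt_of_le_of_ne C.period_nonneg fun h0 ↦ hE (C.period_eq_zero_iff.1 h0.symm)

variable (s hs hcl μ K) in
/-- **The empty curve**, representing `0` ("If `A = 0` then `C = ∅`", McDuff–Salamon 2017,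
Cor. 13.3.23). [cite: McDuffSalamon2017, Cor. 13.3.23] -/
def empty : TaubesCurve s hs hcl μ K 0 where
  r := 0
  S := Fin.elim0
  instTopologicalSpace i := i.elim0
  instCompactSpace i := i.elim0
  instConnectedSpace i := i.elim0
  instChartedSpace i := i.elim0
  instIsManifold i := i.elim0
  b i := i.elim0
  isSmoothEmbedding i := i.elim0
  μS i := i.elim0
  m := Fin.elim0
  one_le i := i.elim0
  nondegenerate i := i.elim0
  area_pos i := i.elim0
  disjoint i := i.elim0
  sum_eq := by rw [map_zero]; exact Finset.sum_of_isEmpty _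
  adjunction i := i.elim0

/-- **The shape of conjunct (iii) of `taubes_canonicalClass_symplecticCurve_four`** from a Taubes
curve with `E = K`, the additive area functional being the symplectic area
`A := periodLinearMap s hs hcl` (`⟨[s], · ⊗ 1⟩`), positive on the components.
[cite: Taubes1995, Thm. A (1), §3 (3.2), Prop. 4.2] -/
theorem conclusion (C : TaubesCurve s hs hcl μ K K) :
    ∃ (r : ℕ) (S : Fin r → Type) (_ : ∀ i, TopologicalSpace (S i))
      (_ : ∀ i, CompactSpace (S i)) (_ : ∀ i, ConnectedSpace (S i))
      (_ : ∀ i, ChartedSpace (𝔼 2) (S i)) (_ : ∀ i, IsManifold (ℛ 2) ∞ (S i))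
      (b : ∀ i, S i → N) (hb : ∀ i, Manifold.IsSmoothEmbedding (ℛ 2) (ℛ 4) ∞ (b i))
      (μS : ∀ i, HomologicalOrientation ℤ (S i) 2) (m : Fin r → ℕ)
      (A : ↥(singularHomology ℤ ℤ N 2) →ₗ[ℤ] ℝ),
      (∀ i, 1 ≤ m i) ∧
      (∀ i y (v : TangentSpace (ℛ 2) y), v ≠ 0 → ∃ w : TangentSpace (ℛ 2) y,
        s (b i y) ![mfderiv (ℛ 2) (ℛ 4) (b i) y v, mfderiv (ℛ 2) (ℛ 4) (b i) y w] ≠ 0) ∧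
      (Pairwise fun i j ↦ Disjoint (Set.range (b i)) (Set.range (b j))) ∧
      (∑ i, (m i : ℤ) • singularHomology.map ℤ ℤ ⟨b i, (hb i).isEmbedding.continuous⟩ 2
          (μS i).fundamentalClass) = poincareDualityMap μ two_add_two_eq_four K ∧
      ∀ i, 0 < A (singularHomology.map ℤ ℤ ⟨b i, (hb i).isEmbedding.continuous⟩ 2
          (μS i).fundamentalClass) ∧
        ∀ σ : ↥(singularCohomology ℤ ℤ N 2),
          poincareDualityMap μ two_add_two_eq_four σ =
            singularHomology.map ℤ ℤ ⟨b i, (hb i).isEmbedding.continuous⟩ 2 (μS i).fundamentalClass →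
          (Module.finrank ℤ ↥(singularHomology ℤ ℤ (S i) 1) : ℤ) - 2 =
            cupPairing μ two_add_two_eq_four σ σ + cupPairing μ two_add_two_eq_four K σ :=
  ⟨C.r, C.S, C.instTopologicalSpace, C.instCompactSpace, C.instConnectedSpace, C.instChartedSpace,
    C.instIsManifold, C.b, C.isSmoothEmbedding, C.μS, C.m, periodLinearMap s hs hcl, C.one_le,
    C.nondegenerate, C.disjoint, C.sum_eq,
    fun i ↦ ⟨by rw [periodLinearMap_apply]; exact C.area_pos i, C.adjunction i⟩⟩

end TaubesCurve

/-- **`E ⌢ [N]_μ` is represented by a Taubes curve with canonical class `K`** (there is a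
`TaubesCurve s hs hcl μ K E`): the conclusion of Taubes 1995, Prop. 4.2 — and, with `E = K = K_J`,
of Thm. A (1) / McDuff–Salamon 2017 Cor. 13.3.24 (ii) "The canonical class `K` is Poincaré dual to
a symplectic submanifold" — as a predicate on named objects (a definition with arguments, not a
named fact: nothing is asserted). [cite: Taubes1995, Thm. A (1) and Prop. 4.2]
[cite: McDuffSalamon2017, §13.3 Cor. 13.3.23 and Cor. 13.3.24 (ii)] -/
def HasTaubesCurve (s : MForm (ℛ 4) N ℝ 2) (hs : IsSmoothForm s) (hcl : IsClosedForm s)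
    (μ : HomologicalOrientation ℤ N 4) (K E : singularCohomology ℤ ℤ N 2) : Prop :=
  Nonempty (TaubesCurve s hs hcl μ K E)

/-- The zero class is represented by the empty Taubes curve. [cite: McDuffSalamon2017, Cor. 13.3.23] -/
theorem hasTaubesCurve_zero (s : MForm (ℛ 4) N ℝ 2) (hs : IsSmoothForm s) (hcl : IsClosedForm s)
    (μ : HomologicalOrientation ℤ N 4) (K : singularCohomology ℤ ℤ N 2) :
    HasTaubesCurve s hs hcl μ K 0 :=
  ⟨TaubesCurve.empty s hs hcl μ K⟩

variable {s : MForm (ℛ 4) N ℝ 2} {hs : IsSmoothForm s} {hcl : IsClosedForm s}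
  {μ : HomologicalOrientation ℤ N 4} {K E : singularCohomology ℤ ℤ N 2}

/-- `E · [s] ≥ 0` when `E ⌢ [N]` is represented by a Taubes curve (McDuff–Salamon Cor. 13.3.24 (iii)).
[cite: McDuffSalamon2017, §13.3 Cor. 13.3.24 (iii)] -/
theorem HasTaubesCurve.period_nonneg (h : HasTaubesCurve s hs hcl μ K E) :
    0 ≤ periodFunctional s hs hcl (poincareDualityMap μ two_add_two_eq_four E) :=
  h.elim fun C ↦ C.period_nonneg

/-- `E · [s] = 0 ↔ E = 0` when `E ⌢ [N]` is represented by a Taubes curve (McDuff–Salamon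
Cor. 13.3.24 (iii)). [cite: McDuffSalamon2017, §13.3 Cor. 13.3.24 (iii)] -/
theorem HasTaubesCurve.period_eq_zero_iff (h : HasTaubesCurve s hs hcl μ K E) :
    periodFunctional s hs hcl (poincareDualityMap μ two_add_two_eq_four E) = 0 ↔ E = 0 :=
  h.elim fun C ↦ C.period_eq_zero_iff

/-- `0 < E · [s]` for `E ≠ 0` represented by a Taubes curve (McDuff–Salamon Cor. 13.3.24 (iii)).
[cite: McDuffSalamon2017, §13.3 Cor. 13.3.24 (iii)] -/
theorem HasTaubesCurve.period_pos (h : HasTaubesCurve s hs hcl μ K E) (hE : E ≠ 0) :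
    0 < periodFunctional s hs hcl (poincareDualityMap μ two_add_two_eq_four E) :=
  h.elim fun C ↦ C.period_pos hE

/-- `K · K = Σ mᵢ² σᵢ · σᵢ ` for the canonical Taubes curve, in existential form. [cite: McDuffSalamon2017, §13.3 Cor. 13.3.23] -/
theorem HasTaubesCurve.exists_cupPairing_self_eq_sum (h : HasTaubesCurve s hs hcl μ K E) :
    ∃ (r : ℕ) (m : Fin r → ℕ) (σ : Fin r → singularCohomology ℤ ℤ N 2),
      (∀ i, 1 ≤ m i) ∧ E = ∑ i, (m i : ℤ) • σ i ∧
      (Pairwise fun i j ↦ cupPairing μ two_add_two_eq_four (σ i) (σ j) = 0) ∧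
      (∀ i, cupPairing μ two_add_two_eq_four E (σ i) = m i * cupPairing μ two_add_two_eq_four (σ i) (σ i)) ∧
      cupPairing μ two_add_two_eq_four E E =
        ∑ i, (m i : ℤ) * m i * cupPairing μ two_add_two_eq_four (σ i) (σ i) :=
  h.elim fun C ↦ ⟨C.r, C.m, C.pd, C.one_le, C.eq_sum_smul_pd, fun _ _ hij ↦ C.cupPairing_pd_pd_eq_zero hij,
    C.cupPairing_pd_eq, C.cupPairing_self_eq_sum⟩

/-- **The shape of conjunct (iii) of `taubes_canonicalClass_symplecticCurve_four`** from
`HasTaubesCurve s hs hcl μ K K`. [cite: Taubes1995, Thm. A (1), §3 (3.2), Prop. 4.2] -/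
theorem HasTaubesCurve.conclusion (h : HasTaubesCurve s hs hcl μ K K) :
    ∃ (r : ℕ) (S : Fin r → Type) (_ : ∀ i, TopologicalSpace (S i))
      (_ : ∀ i, CompactSpace (S i)) (_ : ∀ i, ConnectedSpace (S i))
      (_ : ∀ i, ChartedSpace (𝔼 2) (S i)) (_ : ∀ i, IsManifold (ℛ 2) ∞ (S i))
      (b : ∀ i, S i → N) (hb : ∀ i, Manifold.IsSmoothEmbedding (ℛ 2) (ℛ 4) ∞ (b i))
      (μS : ∀ i, HomologicalOrientation ℤ (S i) 2) (m : Fin r → ℕ)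
      (A : ↥(singularHomology ℤ ℤ N 2) →ₗ[ℤ] ℝ),
      (∀ i, 1 ≤ m i) ∧
      (∀ i y (v : TangentSpace (ℛ 2) y), v ≠ 0 → ∃ w : TangentSpace (ℛ 2) y,
        s (b i y) ![mfderiv (ℛ 2) (ℛ 4) (b i) y v, mfderiv (ℛ 2) (ℛ 4) (b i) y w] ≠ 0) ∧
      (Pairwise fun i j ↦ Disjoint (Set.range (b i)) (Set.range (b j))) ∧
      (∑ i, (m i : ℤ) • singularHomology.map ℤ ℤ ⟨b i, (hb i).isEmbedding.continuous⟩ 2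
          (μS i).fundamentalClass) = poincareDualityMap μ two_add_two_eq_four K ∧
      ∀ i, 0 < A (singularHomology.map ℤ ℤ ⟨b i, (hb i).isEmbedding.continuous⟩ 2
          (μS i).fundamentalClass) ∧
        ∀ σ : ↥(singularCohomology ℤ ℤ N 2),
          poincareDualityMap μ two_add_two_eq_four σ =
            singularHomology.map ℤ ℤ ⟨b i, (hb i).isEmbedding.continuous⟩ 2 (μS i).fundamentalClass →
          (Module.finrank ℤ ↥(singularHomology ℤ ℤ (S i) 1) : ℤ) - 2 =
            cupPairing μ two_add_two_eq_four σ σ + cupPairing μ two_add_two_eq_four K σ :=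
  h.elim fun C ↦ C.conclusion

end TaubesCurve

end Literature.Geometry.Symplectic

end
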